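import Summits.QuantumAdvantage.QuantumAdvantage.Theses.ThirdFactorialPincer
import Literature.NumberTheory.GaussSums.KummerSector
import Literature.Computability.Complexity.Oracle

/-! Sketch: the four split children of `ArgLeg` (stmt-QuantumAdvantage-14637), exactly as filed,
elaborated in the route file's environment (`open scoped Classical` etc. as the gate renders it). -/

set_option linter.dupNamespace false

namespace Summit.QuantumAdvantage.QuantumAdvantage.Theses.ThirdFactorialPincer

open scoped BigOperators Topology Manifold Classical MeasureTheory ProbabilityTheory Matrix InnerProductSpace ComplexConjugate ContinuousMap
open Filter Set Function TopologicalSpace MeasureTheory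

/-- crux X₁ (quantum): Kummer's sector language is in BQP. -/
def KummerSectorBQP : Prop :=
  Literature.NumberTheory.GaussSums.KummerSector ∈ Literature.Computability.Cryptography.BQP

/-- crux X₂ (algebraic): g(χ_{p,g})³ = p·π for the primary prime π ∣ g^{(p-1)/3} − ω of norm p. -/
def GaussCubePrimary : Prop :=
  ∀ (p g : ℕ) (a b c d : ℤ), p.Prime → p % 3 = 1 → IsPrimitiveRoot (g : ZMod p) (p - 1) → a % 3 = 2 → b % 3 = 0 → a * a - a * b + b * b = (p : ℤ) → (((g ^ ((p - 1) / 3) % p : ℕ) : ℂ) - Literature.NumberTheory.GaussSums.omega = ((a : ℂ) + (b : ℂ) * Literature.NumberTheory.GaussSums.omega) * ((c : ℂ) + (d : ℂ) * Literature.NumberTheory.GaussSums.omega)) → Literature.NumberTheory.GaussSums.cubicGaussSum p g ^ 3 = (p : ℂ) * ((a : ℂ) + (b : ℂ) * Literature.NumberTheory.GaussSums.omega)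

/-- crux X₃ (analytic/finite identity): 12 p S_p = √3 · g(χ_p) · T_p, T_p = Σ_{a<3p} θ̄(a) cot(πa/3p), θ̄ = χ̄_p ψ₃. -/
def ArgIdentity : Prop :=
  ∀ (p r g : ℕ), p.Prime → p % 3 = 1 → r < p → (r * r + r + 1) % p = 0 → 2 * r + 1 < p → IsPrimitiveRoot (g : ZMod p) (p - 1) → (g : ZMod p) ^ ((p - 1) / 3) = (r : ZMod p) → 12 * (p : ℂ) * (∑ j ∈ Finset.Icc 1 ((p - 1) / 3), (if (j : ZMod p) ^ ((p - 1) / 3) = 1 then (1 : ℂ) else if (j : ZMod p) ^ ((p - 1) / 3) = (r : ZMod p) then Complex.exp (2 * Real.pi * Complex.I / 3) else Complex.exp (2 * Real.pi * Complex.I / 3) ^ 2)) = (Real.sqrt 3 : ℂ) * Literature.NumberTheory.GaussSums.cubicGaussSum p g * ∑ a ∈ Finset.range (3 * p), ((if (a : ZMod p) = 0 then (0 : ℂ) else if (a : ZMod p) ^ ((p - 1) / 3) = 1 then 1 else if (a : ZMod p) ^ ((p - 1) / 3) = (r : ZMod p) then Complex.exp (2 * Real.pi * Complex.I / 3) ^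 2 else Complex.exp (2 * Real.pi * Complex.I / 3)) * (if a % 3 = 1 then (1 : ℂ) else if a % 3 = 2 then -1 else 0) * (Real.cot (Real.pi * a / (3 * p)) : ℂ))

/-- crux X₄ (classical oracle algorithm): the certified BPP^{KummerSector} algorithm for the argument leg. -/
def ArgLegClassicalBase : Prop :=
  ∃ G : List Bool → List Bool, G ∈ Literature.Computability.Complexity.FPRel (Literature.Computability.Complexity.Oracle.ofLanguage Literature.NumberTheory.GaussSums.KummerSector) ∧ ∃ q : Polynomial ℕ, ∀ x : List Bool, (3 : ℝ) / 4 ≤ Literature.Computability.Complexity.uniformProb (q.eval x.length) {c | G (Literature.Computability.Complexity.boolPair x c) ∈ {z : List Bool | ∀ p r : ℕ, Computability.decodeNat x = p → p.Prime → p % 3 = 1 → r < p → (r * r + r + 1) % p = 0 → 2 * r + 1 < p → ∃ (g k n₂ n₃ : ℕ) (a b u v w : ℤ), IsPrimitiveRoot (g : ZMod p) (p - 1) ∧ (g : ZMod p) ^ ((p - 1) / 3) = (r : ZMod p) ∧ (Literature.NumberTheory.GaussSums.kummerSectorIndex p g : ℕ) = k ∧ a % 3 = 2 ∧ b % 3 =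 0 ∧ a * a - a * b + b * b = (p : ℤ) ∧ (((g ^ ((p - 1) / 3) % p : ℕ) : ℂ) - Literature.NumberTheory.GaussSums.omega = ((a : ℂ) + (b : ℂ) * Literature.NumberTheory.GaussSums.omega) * ((u : ℂ) + (v : ℂ) * Literature.NumberTheory.GaussSums.omega)) ∧ |Complex.arg ((a : ℂ) + (b : ℂ) * Literature.NumberTheory.GaussSums.omega) / 3 + 2 * Real.pi * (k : ℝ) / 3 - 2 * Real.pi * (n₃ : ℝ) / 72 + 2 * Real.pi * (w : ℝ)| ≤ Real.pi / 36 ∧ |Complex.arg ((∑ a ∈ Finset.range (3 * p), ((if (a : ZMod p) = 0 then (0 : ℂ) else if (a : ZMod p) ^ ((p - 1) / 3) = 1 then 1 else if (a : ZMod p) ^ ((p - 1) / 3) = (r : ZMod p) then Complex.exp (2 * Real.pi * Complex.I / 3) ^ 2 else Complex.exp (2 * Real.pi * Complex.I / 3)) * (if a % 3 = 1 then (1 : ℂ) else if a % 3 = 2 then -1 else 0) * (Real.cot (Real.pi * a / (3 * p)) : ℂ))) * Complex.exp (-(2 * Real.pi * Complex.I * (n₂ : ℂ) / 72)))| ≤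 Real.pi / 8 ∧ List.ofFn (fun i : Fin 7 => ((n₂ + n₃) % 72).testBit i.val) <+: z}}

/-- The glue statement (type of the landed `Theorems.ThirdFactorialPincer.ArgLeg_of_subs`). -/
def ArgLegOfSubs : Prop := KummerSectorBQP → GaussCubePrimary → ArgIdentity → ArgLegClassicalBase → ArgLeg

/-- Sanity: `ArgIdentity` is inhabited-in-kind at p = 7? (not attempted here; numerics: 271 primes p ≡ 1 (3), p < 4000,
`12 p S_p = √3 g T_p` to relative error ≤ 1.1e-12, scratch/check_identity.py). -/
example : True := trivial

end Summit.QuantumAdvantage.QuantumAdvantage.Theses.ThirdFactorialPincer
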